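import Literature.Geometry.Lorentzian.CompleteSpacelikeGraph
import Literature.Geometry.Lorentzian.CauchyDevelopment
import Literature.Geometry.Manifold.ChartFromFunctions
import HarnessLib

/-!
# Minkowski space-time is a Cauchy development of complete, uniformly spacelike immersed data

Companion of `CompleteSpacelikeGraph.lean` (a complete spacelike isometric immersion
`f : X³ → (ℝ⁴, η)` projects diffeomorphically onto `{t = 0}`, its image is an entire graph, and
a uniformly spacelike one is a Cauchy hypersurface). Here the conclusion is packaged in the
vocabulary of `CauchyDevelopment.lean`, i.e. in the literal shape
`∃ 𝒟 : CauchyDevelopment D, 𝒟.toSpacetime = Minkowski.spacetime` of the rigid positive energy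
theorem `positive_mass_rigidity_spacetime` (Beig–Chruściel, J. Math. Phys. 37 (1996), Thm. 4.1,
`m = 0`; `SpacetimePositiveMassRigidity.lean`):

* `Minkowski.isSmoothEmbedding_of_complete` — a complete spacelike isometric immersion into
  `(ℝ⁴, η)` is a smooth embedding (Mathlib's `Manifold.IsSmoothEmbedding`): it is the graph map
  `y ↦ (u y, y)` (a closed embedding, `isClosedEmbedding_graph`) precomposed with the
  diffeomorphism `f̲ : X ≅ ℝ³`, and in a chart of `X` agreeing with `f̲`
  (`exists_mem_maximalAtlas_eqOn_of_mfderiv`) and the sheared chart `p ↦ p − u(p̲) ∂ₜ` of `ℝ⁴`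
  it reads `z ↦ (0, z)` (the pattern of `Minkowski.isImmersion_graph`);
* `Minkowski.exists_cauchyDevelopment_eq_spacetime_of_complete` — **main result**: for an
  initial data set `D = (h, k)` on a connected Hausdorff `3`-manifold `X` with complete metric,
  a smooth `f : X → ℝ⁴` with future unit normal `ν`, `f^*η = h`, `K_ν = k`, uniformly spacelike
  (`|dt(df v)| ≤ θ ‖(df v)̲‖`, `θ < 1`), Minkowski space-time `(ℝ⁴, η, ∂ₜ)` with `f`, `ν` is a
  Cauchy development of `D`.

This is the terminal step of the geometric half of the proof of Thm. 4.1 (§4, last paragraph: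
"`Σ` can be isometrically embedded in `ℝ⁴` … necessarily a graph over a spacelike plane
`t = 0` … Moreover `i(Σ)` is an asymptotically flat Cauchy surface"), to be fed with the
isometric immersion integrated from the translational Killing initial data
(`TranslationalKIDImmersion.lean`, `KIDPatchImmersion.lean`) once that integration is global,
and with the boundedness of the lapse of the timelike Killing field. Theorems only; no
definitions, no named facts (D-0026).

## References

* R. Beig, P. T. Chruściel, *Killing vectors in asymptotically flat space-times. I*, J. Math.
  Phys. 37 (1996) 1939–1961, arXiv:gr-qc/9510015: Thm. 4.1 and its proof, §4.
  [BeigChrusciel1996]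
* S. W. Hawking, G. F. R. Ellis, *The large scale structure of space-time*, CUP 1973, §2.3
  (imbedded submanifolds), §6.5 (Cauchy developments). [HawkingEllis1973]
* B. O'Neill, *Semi-Riemannian geometry*, Academic Press 1983, Ch. 14, Def. 14.28.
  [ONeill1983]
-/

noncomputable section

open Bundle Set Function Filter Manifold
open scoped Manifold ContDiff Topology

namespace Literature.Geometry.Lorentzian

namespace Minkowski

section General

variable {X : Type*} [TopologicalSpace X] [ChartedSpace E3 X] [IsManifold (𝓡 3) ∞ X]
  {f : X → E4} {h : PseudoRiemannianMetric (𝓡 3) ∞ E3 (TangentSpace (𝓡 3) : X → Type _)}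
  [T2Space X] [ConnectedSpace X] [h.HasLeviCivita]

/-! ### The immersion is a smooth embedding -/

/-- `∂ₜ` has no spatial part (coordinate bookkeeping). [folklore] -/
private theorem spatial_basisVector_zero' : E4.spatial (E4.basisVector 0) = 0 := by
  ext i
  simp [Fin.succ_ne_zero]

/-- **A complete spacelike isometric immersion into Minkowski space-time is a smooth
embedding** (Mathlib's `Manifold.IsSmoothEmbedding`: a `C^∞` immersion in the chart sense and a
topological embedding). With `Φ = f̲ : X ≅ ℝ³` and the graph function `u`
(`exists_diffeomorph_graph`), `f = (y ↦ (u y, y)) ∘ Φ`: a closed topological embedding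
(`isClosedEmbedding_graph`) composed with a homeomorphism; and around each `x`, in a chart of `X`
agreeing with `Φ` (`exists_mem_maximalAtlas_eqOn_of_mfderiv`, `dΦ_x` being invertible) and the
sheared chart `p ↦ p − u(p̲) ∂ₜ` of `ℝ⁴`, `f` reads `z ↦ (0, z)` (the pattern of
`isImmersion_graph`). Hawking–Ellis 1973, §2.3 (imbedded submanifolds); Beig–Chruściel 1996,
Thm. 4.1 ("an isometric embedding `i` of `Σ` into Minkowski space-time").
[cite: BeigChrusciel1996, Thm. 4.1 and its proof, §4 (last paragraph)] -/
theorem isSmoothEmbedding_of_complete (hf : ContMDiff (𝓡 3) 𝓘(ℝ, E4) ∞ f)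
    (hpos : h.IsRiemannian)
    (hiso : ∀ (x : X) (v w : TangentSpace (𝓡 3) x),
      bilin (mfderiv (𝓡 3) 𝓘(ℝ, E4) f x v) (mfderiv (𝓡 3) 𝓘(ℝ, E4) f x w) = h.val x v w)
    (hc : IsGeodesicallyComplete h.leviCivita) :
    Manifold.IsSmoothEmbedding (𝓡 3) 𝓘(ℝ, E4) ∞ f := by
  obtain ⟨Φ, u, hu, hΦ, -, hfu, -⟩ := exists_diffeomorph_graph hf hpos hiso hc
  have hfeq : f = (fun y : E3 ↦ E4.ofTimeSpace (u y) y) ∘ Φ := funext fun x ↦ hfu x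
  refine ⟨⟨ℝ, inferInstance, inferInstance, fun x ↦ ?_⟩, ?_⟩
  swap
  · rw [hfeq]
    exact (isClosedEmbedding_graph hu.continuous).isEmbedding.comp Φ.toHomeomorph.isEmbedding
  -- the linear isomorphism `(y, t) ↦ (t, y) : E3 × ℝ ≅ E4`
  let eₗ : (E3 × ℝ) ≃ₗ[ℝ] E4 :=
    { toFun := fun p ↦ E4.ofTimeSpace p.2 p.1
      map_add' := fun p q ↦ E4.ofTimeSpace_add p.2 q.2 p.1 q.1
      map_smul' := fun c p ↦ E4.ofTimeSpace_smul c p.2 p.1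
      invFun := fun v ↦ (E4.spatial v, E4.time v)
      left_inv := fun p ↦ by simp
      right_inv := fun v ↦ E4.ofTimeSpace_time_spatial v }
  let e : (E3 × ℝ) ≃L[ℝ] E4 := eₗ.toContinuousLinearEquiv
  have he : ∀ p : E3 × ℝ, e p = E4.ofTimeSpace p.2 p.1 := fun _ ↦ rfl
  -- the shear `p ↦ p − u(p̲) ∂ₜ` and its inverse
  have hsp : ∀ (p : E4) (c : ℝ), E4.spatial (p + c • E4.basisVector 0) = E4.spatial p := by
    intro p c
    rw [map_add, map_smul, spatial_basisVector_zero', smul_zero, add_zero]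
  have hsp' : ∀ (p : E4) (c : ℝ), E4.spatial (p - c • E4.basisVector 0) = E4.spatial p := by
    intro p c
    rw [sub_eq_add_neg, ← neg_smul, hsp]
  let Ψ : E4 ≃ₜ E4 :=
    { toFun := fun p ↦ p - u (E4.spatial p) • E4.basisVector 0
      invFun := fun p ↦ p + u (E4.spatial p) • E4.basisVector 0
      left_inv := fun p ↦ by simp only [hsp']; abel
      right_inv := fun p ↦ by simp only [hsp]; abel
      continuous_toFun := continuous_id.sub
        ((hu.continuous.comp E4.spatial.continuous).smul continuous_const)
      continuous_invFun := continuous_id.add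
        ((hu.continuous.comp E4.spatial.continuous).smul continuous_const) }
  have hΨ : ContDiff ℝ ∞ (Ψ : E4 → E4) :=
    contDiff_id.sub ((hu.comp E4.spatial.contDiff).smul contDiff_const)
  have hΨs : ContDiff ℝ ∞ (Ψ.symm : E4 → E4) :=
    contDiff_id.add ((hu.comp E4.spatial.contDiff).smul contDiff_const)
  have hmem : Ψ.toOpenPartialHomeomorph ∈ IsManifold.maximalAtlas 𝓘(ℝ, E4) ∞ E4 := by
    apply StructureGroupoid.mem_maximalAtlas_of_mem_groupoid
    rw [contDiffGroupoid, mem_groupoid_of_pregroupoid]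
    refine ⟨?_, ?_⟩
    · simpa [contDiffPregroupoid] using hΨ.contDiffOn
    · simpa [contDiffPregroupoid] using hΨs.contDiffOn
  -- a chart of `X` at `x` agreeing with `Φ`
  obtain ⟨ψX, hψX, hxψ, -, hψΦ⟩ :=
    Literature.Geometry.Manifold.exists_mem_maximalAtlas_eqOn_of_mfderiv (M := X) isOpen_univ
      Φ.contMDiff.contMDiffOn (mem_univ x) (Φ.mfderivToContinuousLinearEquiv (by simp) x)
      (Φ.mfderivToContinuousLinearEquiv_coe (by simp)).symm
  refine Manifold.IsImmersionAtOfComplement.mk_of_continuousAt hf.continuous.continuousAt e ψX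
    Ψ.toOpenPartialHomeomorph hxψ (by simp) hψX hmem ?_
  intro z hz
  have hz' : z ∈ ψX.target := by
    simpa [OpenPartialHomeomorph.extend_target] using hz
  have hw : ψX.symm z ∈ ψX.source := ψX.map_target hz'
  have hΦw : Φ (ψX.symm z) = z := by rw [← hψΦ _ hw, ψX.right_inv hz']
  calc (Ψ.toOpenPartialHomeomorph.extend 𝓘(ℝ, E4)) (f ((ψX.extend (𝓡 3)).symm z))
      = Ψ (f (ψX.symm z)) := rfl
    _ = Ψ (E4.ofTimeSpace (u z) z) := by rw [hfu (ψX.symm z), hΦw]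
    _ = E4.ofTimeSpace 0 z := by
        change E4.ofTimeSpace (u z) z - u (E4.spatial (E4.ofTimeSpace (u z) z)) • E4.basisVector 0
          = E4.ofTimeSpace 0 z
        rw [E4.spatial_ofTimeSpace, E4.ofTimeSpace_eq_smul_add (u z) z]
        abel
    _ = e (z, 0) := (he (z, 0)).symm

end General

/-! ### Minkowski space-time is a Cauchy development of the data of a complete, uniformly
spacelike isometric immersion -/

section Development

variable {X : Type} [TopologicalSpace X] [ChartedSpace E3 X] [IsManifold (𝓡 3) ∞ X]
  [T2Space X] [ConnectedSpace X] {f : X → E4}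

/-- **Minkowski space-time is a Cauchy development of complete, uniformly spacelike immersed
data.** Let `D = (h, k)` be an initial data set on the connected Hausdorff `3`-manifold `X`
whose metric is (geodesically) complete, and let `f : X → (ℝ⁴, η)` be a smooth map with a
future unit normal field `ν` such that `f^*η = h`, `K_ν = k`, and `f` is uniformly spacelike,
`|dt(df v)| ≤ θ ‖(df v)̲‖` with `θ < 1`. Then `(ℝ⁴, η, ∂ₜ)` together with `f` and `ν` is a
Cauchy development of `D` (`f` is a smooth embedding, `isSmoothEmbedding_of_complete`, whose
image is a Cauchy hypersurface, `isCauchyHypersurface_range_of_complete`), so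
`∃ 𝒟 : CauchyDevelopment D, 𝒟.toSpacetime = Minkowski.spacetime` — the literal conclusion of
the rigid positive energy theorem `positive_mass_rigidity_spacetime` (Beig–Chruściel, J. Math.
Phys. 37 (1996), Thm. 4.1, `m = 0`), i.e. the terminal step of the geometric half of its proof
(§4, last paragraph), which any discharge of the fact feeds with the isometric immersion
integrated from the translational Killing initial data (`TranslationalKIDImmersion.lean`,
`KIDPatchImmersion.lean`) and the boundedness of the lapse.
[cite: BeigChrusciel1996, Thm. 4.1 and its proof, §4 (last paragraph)] -/
theorem exists_cauchyDevelopment_eq_spacetime_of_complete (D : InitialDataSet (𝓡 3) X)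
    [D.metric.HasLeviCivita] (hc : D.IsComplete) (hf : ContMDiff (𝓡 3) 𝓘(ℝ, E4) ∞ f)
    (ν : X → E4) (hν : smoothMetric.IsFutureUnitNormal (𝓡 3) (timeOrientation.ofLE le_top) f ν)
    (hh : ∀ y : X, pullbackBilin (I := 𝓘(ℝ, E4)) (I' := 𝓡 3) f smoothMetric.val y = D.h.inner y)
    (hk : ∀ [smoothMetric.toPseudoRiemannianMetric.HasLeviCivita] (y : X),
      smoothMetric.toPseudoRiemannianMetric.secondFundamentalForm (𝓡 3) f ν y = D.kBilin y)
    {θ : NNReal} (hθ : θ < 1)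
    (hus : ∀ (x : X) (v : TangentSpace (𝓡 3) x),
      |E4.time (mfderiv (𝓡 3) 𝓘(ℝ, E4) f x v)| ≤
        θ * ‖E4.spatial (mfderiv (𝓡 3) 𝓘(ℝ, E4) f x v)‖) :
    ∃ 𝒟 : CauchyDevelopment D, 𝒟.toSpacetime = spacetime := by
  haveI := smoothMetric.toPseudoRiemannianMetric.hasLeviCivita
  have hiso : ∀ (x : X) (v w : TangentSpace (𝓡 3) x),
      bilin (mfderiv (𝓡 3) 𝓘(ℝ, E4) f x v) (mfderiv (𝓡 3) 𝓘(ℝ, E4) f x w) =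
        D.metric.val x v w := by
    intro x v w
    rw [InitialDataSet.val_metric, ← hh x]
    rfl
  exact ⟨
    { toSpacetime := spacetime
      embed := f
      isSmoothEmbedding := isSmoothEmbedding_of_complete hf D.isRiemannian_metric hiso hc
      normal := ν
      isFutureUnitNormal := hν
      induced_h := hh
      induced_k := fun y ↦ hk y
      isCauchyHypersurface :=
        isCauchyHypersurface_range_of_complete hf D.isRiemannian_metric hiso hc hθ hus }, rfl⟩


/-! ### Uniform spacelikeness from a bound on the lapse of the unit normal -/

omit [T2Space X] [ConnectedSpace X] in
/-- `η(v, w) = −v⁰ w⁰ + ⟪v̲, w̲⟫` (O'Neill 1983, Ch. 3, p. 55). [cite: ONeill1983, Ch. 3, p. 55] -/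
theorem bilin_eq_time_spatial (v w : E4) :
    bilin v w = -(E4.time v * E4.time w) + @inner ℝ E3 _ (E4.spatial v) (E4.spatial w) := by
  rw [bilin_apply, E4.time_apply, E4.time_apply]
  simp only [PiLp.inner_apply, E4.spatial_apply, RCLike.inner_apply, conj_trivial]
  congr 1
  exact Finset.sum_congr rfl fun i _ ↦ mul_comm _ _

omit [T2Space X] [ConnectedSpace X] in
/-- **The tilt of a spacelike plane is controlled by the lapse of its unit normal.** If `ν` is a
unit timelike vector (`η(ν, ν) = −1`) with `0 < ν⁰ ≤ C` and `w` is `η`-orthogonal to `ν`, then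
`|w⁰| ≤ √(1 − C⁻²) ‖w̲‖`: from `ν⁰ w⁰ = ⟪ν̲, w̲⟫` and `‖ν̲‖² = (ν⁰)² − 1` (Cauchy–Schwarz).
Wald 1984, §10.2 (lapse of a spacelike hypersurface); O'Neill 1983, Ch. 5, p. 144.
[cite: ONeill1983, Ch. 5, p. 144] -/
theorem abs_time_le_of_bilin_normal_eq_zero {ν w : E4} (hνν : bilin ν ν = -1)
    (hνw : bilin ν w = 0) (h0 : 0 < E4.time ν) {C : ℝ} (hC : E4.time ν ≤ C) :
    |E4.time w| ≤ Real.sqrt (1 - (C ^ 2)⁻¹) * ‖E4.spatial w‖ := by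
  set a := E4.time ν with ha
  set s := E4.time w with hs
  have hb : ‖E4.spatial ν‖ ^ 2 = a ^ 2 - 1 := by
    have h1 := hνν
    rw [bilin_eq_time_spatial, real_inner_self_eq_norm_sq] at h1
    linarith
  have has : a * s = @inner ℝ E3 _ (E4.spatial ν) (E4.spatial w) := by
    have h1 := hνw
    rw [bilin_eq_time_spatial] at h1
    linarith
  have hcs : |a * s| ≤ ‖E4.spatial ν‖ * ‖E4.spatial w‖ := by
    rw [has]
    exact abs_real_inner_le_norm _ _
  have ha1 : 1 ≤ a ^ 2 := by nlinarith [norm_nonneg (E4.spatial ν)]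
  have hCpos : 0 < C := h0.trans_le hC
  -- `‖ν̲‖ / a = √(1 − a⁻²) ≤ √(1 − C⁻²)`
  have hratio : ‖E4.spatial ν‖ ≤ Real.sqrt (1 - (C ^ 2)⁻¹) * a := by
    have h1 : ‖E4.spatial ν‖ = Real.sqrt (a ^ 2 - 1) := by
      rw [← hb, Real.sqrt_sq (norm_nonneg _)]
    have h2 : a ^ 2 - 1 ≤ (1 - (C ^ 2)⁻¹) * a ^ 2 := by
      have h3 : (C ^ 2)⁻¹ * a ^ 2 ≤ 1 := by
        rw [inv_mul_le_iff₀ (by positivity), mul_one]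
        exact pow_le_pow_left₀ h0.le hC 2
      nlinarith
    have h3 : Real.sqrt ((1 - (C ^ 2)⁻¹) * a ^ 2) = Real.sqrt (1 - (C ^ 2)⁻¹) * a := by
      rw [Real.sqrt_mul' _ (sq_nonneg a), Real.sqrt_sq h0.le]
    rw [h1, ← h3]
    exact Real.sqrt_le_sqrt h2
  have key : a * |s| ≤ a * (Real.sqrt (1 - (C ^ 2)⁻¹) * ‖E4.spatial w‖) := by
    calc a * |s| = |a * s| := by rw [abs_mul, abs_of_pos h0]
      _ ≤ ‖E4.spatial ν‖ * ‖E4.spatial w‖ := hcs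
      _ ≤ Real.sqrt (1 - (C ^ 2)⁻¹) * a * ‖E4.spatial w‖ := by
          gcongr
      _ = a * (Real.sqrt (1 - (C ^ 2)⁻¹) * ‖E4.spatial w‖) := by ring
  exact le_of_mul_le_mul_left key h0

/-- **Minkowski space-time is a Cauchy development of complete immersed data with bounded
lapse** — `exists_cauchyDevelopment_eq_spacetime_of_complete` with the uniform spacelikeness
supplied by a bound `ν⁰ ≤ C` on the time component (the lapse `−η(∂ₜ, ν)`) of the future unit
normal (`abs_time_le_of_bilin_normal_eq_zero`, `θ = √(1 − C⁻²) < 1`). In the rigid positive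
energy theorem (Beig–Chruściel 1996, Thm. 4.1) `ν⁰` is the lapse `N₀` of the asymptotically
translational timelike Killing initial datum, continuous and asymptotically constant, hence
bounded. [cite: BeigChrusciel1996, Thm. 4.1 and its proof, §4 (last paragraph)] -/
theorem exists_cauchyDevelopment_eq_spacetime_of_complete_of_time_normal_le
    (D : InitialDataSet (𝓡 3) X) [D.metric.HasLeviCivita] (hc : D.IsComplete)
    (hf : ContMDiff (𝓡 3) 𝓘(ℝ, E4) ∞ f) (ν : X → E4)
    (hν : smoothMetric.IsFutureUnitNormal (𝓡 3) (timeOrientation.ofLE le_top) f ν)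
    (hh : ∀ y : X, pullbackBilin (I := 𝓘(ℝ, E4)) (I' := 𝓡 3) f smoothMetric.val y = D.h.inner y)
    (hk : ∀ [smoothMetric.toPseudoRiemannianMetric.HasLeviCivita] (y : X),
      smoothMetric.toPseudoRiemannianMetric.secondFundamentalForm (𝓡 3) f ν y = D.kBilin y)
    {C : ℝ} (hC : ∀ x, E4.time (ν x) ≤ C) :
    ∃ 𝒟 : CauchyDevelopment D, 𝒟.toSpacetime = spacetime := by
  obtain ⟨x₀⟩ := (inferInstance : Nonempty X)
  have h0 : ∀ x, 0 < E4.time (ν x) := fun x ↦ by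
    have h1 := (hν.2 x).2
    change bilin (E4.basisVector 0) (ν x) < 0 at h1
    rw [bilin_basisVector_zero_left] at h1
    rw [E4.time_apply]
    linarith
  have hCpos : 0 < C := (h0 x₀).trans_le (hC x₀)
  have hθnn : 0 ≤ Real.sqrt (1 - (C ^ 2)⁻¹) := Real.sqrt_nonneg _
  set θ : NNReal := ⟨Real.sqrt (1 - (C ^ 2)⁻¹), hθnn⟩ with hθdef
  have hθ : θ < 1 := by
    rw [← NNReal.coe_lt_coe]
    show Real.sqrt (1 - (C ^ 2)⁻¹) < (1 : ℝ)
    rw [Real.sqrt_lt' one_pos, one_pow]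
    linarith [inv_pos.2 (pow_pos hCpos 2)]
  refine exists_cauchyDevelopment_eq_spacetime_of_complete D hc hf ν hν hh hk hθ fun x v ↦ ?_
  have hνν : bilin (ν x) (ν x) = -1 := hν.1.2 x
  have hνw : bilin (ν x) (mfderiv (𝓡 3) 𝓘(ℝ, E4) f x v) = 0 := hν.1.1 x v
  exact abs_time_le_of_bilin_normal_eq_zero hνν hνw (h0 x) (hC x)

end Development

end Minkowski

end Literature.Geometry.Lorentzian

end
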